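import Summits.CriticalPhenomena.CardyFormulaZ2.Theses.CardyRotToConf
import Literature.Probability.RandomPlanarGeometry.BrownianPathFreezingIntegrable
import HarnessLib

/-!
# Freezing the past for integrable functionals of the Brownian path
# (brick (c1) of `stub_isLocal`, crux `CardyRotToConfR2SymmetryUpgrade`, stmt-CriticalPhenomena-0698)

Stub `stub_brownianFreezingIntegrable` of line `germ-label-transport` (lead skeleton
`CardyRotToConfR2SymmetryUpgrade`, brick (c1) of `stub_isLocal`: locality of SLE₆ in restriction form, whose
one-step conditional estimates of the image driving value `W̃` of Lawler–Schramm–Werner (2003), §5, freeze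
the Brownian past at a fixed time and need an INTEGRABLE — not bounded — functional of the future, the
increments of `W̃` having Gaussian tails). For `s ≥ 0`, `H` bounded measurable and `Φ` measurable on
`C(ℝ≥0, ℝ)` with `Φ ∘ β` integrable under the pre-Wiener measure (`β(ω)` the continuous Brownian path),
the frozen conditional expectation `ω ↦ E_{ω₂}[Φ(concat_s(stop_s β(ω), β(ω₂)))]` is integrable and

  `E[H(stop_s β) · Φ(β)] = E_ω[H(stop_s β(ω)) · E_{ω₂}[Φ(concat_s(stop_s β(ω), β(ω₂)))]]`.

This file is the registered one-line form of the Literature theorem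
`integral_mul_eq_integral_integral_concat_of_integrable` of
`Literature/Probability/RandomPlanarGeometry/BrownianPathFreezingIntegrable.lean`, where the mathematics
lives (independence of the increments from the stopped path, equality in law of the increment process and
the path, `β = concat_s(stop_s β, incr_s β)`, Fubini for the integrable functional
`(p, q) ↦ H(p) Φ(concat_s(p, q))` on the product of the laws). The registered signature names the random
path `PathOps.brownianCPath`; the alias below makes that name denote the tree's
`Literature.Probability.RandomPlanarGeometry.brownianCPath` (no new declaration).

References: J.-F. Le Gall, *Brownian Motion, Martingales, and Stochastic Calculus* (2016), Prop. 2.5 (iii)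
(simple Markov property); G. F. Lawler, O. Schramm, W. Werner, *Conformal restriction: the chordal case*,
J. Amer. Math. Soc. 16 (2003), §5.
-/

noncomputable section

open MeasureTheory
open Literature.Probability Literature.Probability.RandomPlanarGeometry
  Literature.Probability.RandomPlanarGeometry.PathOps

namespace Literature.Probability.RandomPlanarGeometry.PathOps

-- alias only (no declaration): `PathOps.brownianCPath` = `Literature.Probability.RandomPlanarGeometry.brownianCPath`
export Literature.Probability.RandomPlanarGeometry (brownianCPath)

end Literature.Probability.RandomPlanarGeometry.PathOps

namespace Summit.CriticalPhenomena.CardyFormulaZ2.Theorems.CardyRotToConfR2SymmetryUpgrade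

/-- **Stub `stub_brownianFreezingIntegrable`** (brick (c1) of `stub_isLocal`, registered form): freezing the
Brownian past at time `s` for `H` bounded measurable and `Φ` measurable with `Φ ∘ β` integrable — the frozen
conditional expectation `ω ↦ ∫ Φ(concat_s(stop_s β(ω), β(ω₂))) dP(ω₂)` is integrable and
`∫ H(stop_s β) Φ(β) dP = ∫ H(stop_s β(ω)) (∫ Φ(concat_s(stop_s β(ω), β(ω₂))) dP(ω₂)) dP(ω)`
(`integral_mul_eq_integral_integral_concat_of_integrable`). Le Gall (2016), Prop. 2.5 (iii);
Lawler–Schramm–Werner (2003), §5. -/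
theorem stub_brownianFreezingIntegrable : ∀ [MeasurableSpace C(NNReal, ℝ)] [BorelSpace C(NNReal, ℝ)]
    (s : NNReal) {H Φ : C(NNReal, ℝ) → ℝ}, Measurable H → Measurable Φ → ∀ {C : ℝ}, (∀ p, |H p| ≤ C) →
    MeasureTheory.Integrable (fun ω ↦ Φ (PathOps.brownianCPath ω)) Process.preWienerMeasure →
    MeasureTheory.Integrable (fun ω ↦ ∫ ω₂, Φ (PathOps.concat s (PathOps.stop s (PathOps.brownianCPath ω),
    PathOps.brownianCPath ω₂)) ∂Process.preWienerMeasure) Process.preWienerMeasure ∧ ∫ ω, H (PathOps.stop s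
    (PathOps.brownianCPath ω)) * Φ (PathOps.brownianCPath ω) ∂Process.preWienerMeasure = ∫ ω, H (PathOps.stop s
    (PathOps.brownianCPath ω)) * (∫ ω₂, Φ (PathOps.concat s (PathOps.stop s (PathOps.brownianCPath ω),
    PathOps.brownianCPath ω₂)) ∂Process.preWienerMeasure) ∂Process.preWienerMeasure :=
  by
  intro _ _ s _ _ hHm hΦm _ hH hΦi
  exact integral_mul_eq_integral_integral_concat_of_integrable s hHm hΦm hH hΦi

end Summit.CriticalPhenomena.CardyFormulaZ2.Theorems.CardyRotToConfR2SymmetryUpgrade
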